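import Mathlib
import Summits.Ventures.PercRepro2.A3CutPullBase

/-!
# The mark `b` behind a cut vertex `y` of the explored vertex pulls back to `y`
(blind cell PercRepro2, night-1 g33; proofs/NIGHT1-G33.md §8; census mining/night-1/g33/check_mark_pull.py
186/186)

Setting of A3CutPullBase: `y` a cut vertex, `x, o, a₁, a₂ ∈ VB ∪ {y}`, the mark `b ∈ VA` behind `y`.
On the fibres `W ∌ y` the masses of `b` are `P(y ↔ b)` times those of `y` termwise (`Ssig_pull_notMem`);
on a fibre `W ∋ y` the ratio `σ_b/m_W` is the constant `[a₁ ∈ W ∧ b ∈ W] − [a₂ ∈ W ∧ b ∈ W]`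
(`term_b_of_mem`) and on the fibres with a root `F⁰_o` is affine in the fibre probabilities
(`SFg_of_mem_a1`, `SFg_of_mem_a2`), so the sum over the fibres `W ∋ y, a_i ∈ W, b ∈ W` is the probability
of a `B`-side event intersected with `{x ↔ b}` (`sum_filter_fibre_inter`), which carries the factor
`P(y ↔ b)` (`prob_inter_conn_b`): `∑_{W ∋ y} Sb F⁰_o / m_W = P(y ↔ b) ∑_{W ∋ y} Sy F⁰_o / m_W`
(`sum_term_b_mem`).  The remaining sums pull back globally (`sum_Ssig_pull`, `Do_pull`, `mU_pull`,
`Su_pull_fibresA`).  Hence **`btw(x; b) = P(y ↔ b) · btw(x; y)`** (`btw_pull_b`) and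
**`FMfun(x; b) = P(y ↔ b) · FMfun(x; y)`** (`FMfun_pull_b`), and (MEANS-a₃), (FM), (HCOV) at `x` with
the mark `b` follow from the same statements with `b` moved to the cut vertex `y` (`A3Between_pull_b`,
`FM_pull_b`, `HCov_pull_b`).  Standard axioms.
-/

namespace Summit.Ventures.PercRepro2

open UnionCluster CovForm CutV

namespace CovForm

namespace A3Fibre

namespace MarkPull

section PullB

variable {V : Type*} {E : Type*} [Fintype V] [DecidableEq V] [Fintype E] [DecidableEq E]
  {R : Type*} [Field R] [LinearOrder R] [IsStrictOrderedRing R] {ends : E → Sym2 V} {y : V}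
  {VA VB : Finset V} {EA EB : Set E} [DecidablePred (· ∈ EA)] [DecidablePred (· ∈ EB)] {p : E → R}
  {x a₁ a₂ o b : V}

/-! ## Fibre sums over a filter -/

omit [Fintype V] [DecidableEq V] [Fintype E] [DecidableEq E] [Field R] [LinearOrder R]
  [IsStrictOrderedRing R] [DecidablePred (· ∈ EA)] [DecidablePred (· ∈ EB)] in
/-- On a fibre of `x`, `v ∈ W` iff `x ↔ v`. -/
lemma mem_iff_conn_of_mem_fibre {W : Finset V} {ω : Config E} (hω : ω ∈ fibre ends a₁ a₂ x W)
    (v : V) : v ∈ W ↔ ω ∈ connEvent ends x v := by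
  rw [← Finset.mem_coe, ← hω.2]
  exact Iff.rfl

omit [LinearOrder R] [IsStrictOrderedRing R] [DecidablePred (· ∈ EA)] [DecidablePred (· ∈ EB)] in
/-- **The fibres over a filter partition the corresponding event**: if `F W` is read on the fibre `W` as
the event `G`, then `∑_{W : F W} P(fibre_W ∩ Z) = P(Q ∩ Z ∩ G)`. -/
lemma sum_filter_fibre_inter (Z : Set (Config E)) (F : Finset V → Prop) [DecidablePred F]
    (G : Set (Config E)) (hFG : ∀ W, ∀ ω ∈ fibre ends a₁ a₂ x W, (F W ↔ ω ∈ G)) :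
    ∑ W ∈ Finset.univ.filter F, prob p (fibre ends a₁ a₂ x W ∩ Z) =
      prob p (avoidAll ends a₂ {a₁} ∩ Z ∩ G) := by
  rw [show avoidAll ends a₂ {a₁} ∩ Z ∩ G = avoidAll ends a₂ {a₁} ∩ (Z ∩ G) from
    Set.inter_assoc _ _ _, ← sum_prob_fibre_inter p ends a₁ a₂ x (Z ∩ G), Finset.sum_filter]
  refine Finset.sum_congr rfl fun W _ => ?_
  by_cases hF : F W
  · rw [if_pos hF]
    congr 1
    ext ω
    simp only [Set.mem_inter_iff]
    constructor
    · rintro ⟨hω, hZ⟩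
      exact ⟨hω, hZ, (hFG W ω hω).1 hF⟩
    · rintro ⟨hω, hZ, _⟩
      exact ⟨hω, hZ⟩
  · rw [if_neg hF]
    have e : fibre ends a₁ a₂ x W ∩ (Z ∩ G) = ∅ := by
      ext ω
      simp only [Set.mem_inter_iff, Set.mem_empty_iff_false, iff_false, not_and]
      intro hω _ hG
      exact hF ((hFG W ω hω).2 hG)
    rw [e, prob_empty]

omit [Fintype V] [Fintype E] [DecidableEq E] [Field R] [LinearOrder R] [IsStrictOrderedRing R]
  [DecidablePred (· ∈ EA)] in
/-- Two `B`-side events intersect to a `B`-side event. -/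
lemma inter_eq_sideEventB {A B : Set (Config E)} (hA : A = sideEvent EB A)
    (hB : B = sideEvent EB B) : A ∩ B = sideEvent EB (A ∩ B) := by
  rw [← sideEvent_inter, ← hA, ← hB]

omit [Fintype V] [LinearOrder R] [IsStrictOrderedRing R] in
/-- `P(Y, x ↔ y, x ↔ r, x ↔ b) = P(Y, x ↔ y, x ↔ r) · P(y ↔ b)` for a `B`-side `Y` and `b ∈ VA`. -/
lemma prob_inter_conn_b (h : IsCut ends y ↑VA ↑VB EA EB) (hx : x ∈ insert y VB) (hb : b ∈ VA)
    {r : V} (hr : r ∈ insert y VB) {Y : Set (Config E)} (hY : Y = sideEvent EB Y) :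
    prob p (Y ∩ (connEvent ends x y ∩ connEvent ends x r ∩ connEvent ends x b)) =
      prob p (Y ∩ (connEvent ends x y ∩ connEvent ends x r)) * prob p (connEvent ends y b) := by
  have e1 : Y ∩ (connEvent ends x y ∩ connEvent ends x r ∩ connEvent ends x b) =
      Y ∩ (connEvent ends x y ∩ connEvent ends x r) ∩ connEvent ends x b :=
    (Set.inter_assoc _ _ _).symm
  have e2 : Y ∩ (connEvent ends x y ∩ connEvent ends x r) ∩ connEvent ends x y =
      Y ∩ (connEvent ends x y ∩ connEvent ends x r) := by
    ext ω
    simp only [Set.mem_inter_iff]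
    tauto
  have hY' : Y ∩ (connEvent ends x y ∩ connEvent ends x r) =
      sideEvent EB (Y ∩ (connEvent ends x y ∩ connEvent ends x r)) :=
    inter_eq_sideEventB hY (inter_eq_sideEventB
      (connEvent_eq_sideEventB' h hx (Finset.mem_insert_self y VB)) (connEvent_eq_sideEventB' h hx hr))
  rw [e1, prob_inter_conn_pull h hx hb hY', e2]
omit [Fintype V] [DecidableEq V] [Fintype E] [DecidableEq E] [Field R] [LinearOrder R]
  [IsStrictOrderedRing R] [DecidablePred (· ∈ EA)] [DecidablePred (· ∈ EB)] in
/-- `Y ∩ {x ↔ y, x ↔ r, x ↔ y} = Y ∩ {x ↔ y, x ↔ r}`. -/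
lemma inter_conn_y_self (Y : Set (Config E)) (r : V) :
    Y ∩ (connEvent ends x y ∩ connEvent ends x r ∩ connEvent ends x y) =
      Y ∩ (connEvent ends x y ∩ connEvent ends x r) := by
  ext ω
  simp only [Set.mem_inter_iff]
  tauto

/-! ## The functional on the root fibres -/
omit [Fintype V] [LinearOrder R] [IsStrictOrderedRing R] [DecidablePred (· ∈ EA)]
  [DecidablePred (· ∈ EB)] in
/-- On a fibre containing `a₁`, `F⁰_o(γ) = γ m_W − 2 P(fibre, a₂ ↔ o)`. -/
lemma SFg_of_mem_a1 (o : V) (γ : R) {W : Finset V} (ha1 : a₁ ∈ W) :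
    RootEdge.SFg p ends o a₁ a₂ x γ W =
      γ * mW p ends a₁ a₂ x W - 2 * prob p (fibre ends a₁ a₂ x W ∩ connEvent ends a₂ o) := by
  unfold RootEdge.SFg Ssig Su s3
  rw [if_pos ha1]
  ring

omit [Fintype V] [LinearOrder R] [IsStrictOrderedRing R] [DecidablePred (· ∈ EA)]
  [DecidablePred (· ∈ EB)] in
/-- On a fibre containing `a₂`, `F⁰_o(γ) = 2 P(fibre, a₁ ↔ o) − γ m_W`. -/
lemma SFg_of_mem_a2 (o : V) (γ : R) {W : Finset V} (ha2 : a₂ ∈ W) :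
    RootEdge.SFg p ends o a₁ a₂ x γ W =
      2 * prob p (fibre ends a₁ a₂ x W ∩ connEvent ends a₁ o) - γ * mW p ends a₁ a₂ x W := by
  unfold RootEdge.SFg Ssig Su s3 mW
  by_cases ha1 : a₁ ∈ W
  · rw [fibre_eq_empty_of_mem_mem ends a₁ a₂ x ha1 ha2]
    simp
  · rw [if_neg ha1, if_pos ha2]
    ring

omit [Fintype V] [DecidablePred (· ∈ EA)] [DecidablePred (· ∈ EB)] in
/-- On a fibre of mass zero `F⁰_o(γ)` vanishes. -/
lemma SFg_eq_zero_of_mW_eq_zero (hp : IsProbVec p) (o : V) (γ : R) {W : Finset V}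
    (hm : mW p ends a₁ a₂ x W = 0) : RootEdge.SFg p ends o a₁ a₂ x γ W = 0 := by
  unfold RootEdge.SFg Ssig Su
  rw [hm]
  unfold mW at hm
  rw [prob_fibre_inter_eq_zero hp ends a₁ a₂ x hm, prob_fibre_inter_eq_zero hp ends a₁ a₂ x hm]
  ring

/-! ## The `σ_b`-term on the fibres containing `y` -/
omit [Fintype V] in
/-- On a fibre `W ∋ y`, `Sb · F⁰_o / m_W = [a₁ ∈ W ∧ b ∈ W] F⁰_o − [a₂ ∈ W ∧ b ∈ W] F⁰_o`. -/
lemma term_b_of_mem (hp : IsProbVec p) (h : IsCut ends y ↑VA ↑VB EA EB) (h1 : a₁ ∈ insert y VB)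
    (h2 : a₂ ∈ insert y VB) (hb : b ∈ VA) {W : Finset V} (hW : y ∈ W) (γ : R) :
    Ssig p ends a₁ a₂ x b W * RootEdge.SFg p ends o a₁ a₂ x γ W / mW p ends a₁ a₂ x W =
      (if a₁ ∈ W ∧ b ∈ W then RootEdge.SFg p ends o a₁ a₂ x γ W else 0) -
        (if a₂ ∈ W ∧ b ∈ W then RootEdge.SFg p ends o a₁ a₂ x γ W else 0) := by
  by_cases hm : mW p ends a₁ a₂ x W = 0
  · rw [hm, div_zero, SFg_eq_zero_of_mW_eq_zero hp o γ hm]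
    simp
  · have e : Ssig p ends a₁ a₂ x b W =
        ((if a₁ ∈ W ∧ b ∈ W then 1 else 0) - (if a₂ ∈ W ∧ b ∈ W then 1 else 0)) *
          mW p ends a₁ a₂ x W := by
      unfold Ssig mW
      rw [fibre_inter_conn_of_mem h h1 hb hW, fibre_inter_conn_of_mem h h2 hb hW]
      by_cases c1 : a₁ ∈ W ∧ b ∈ W <;> by_cases c2 : a₂ ∈ W ∧ b ∈ W
      · simp only [if_pos c1, if_pos c2]
        ring
      · simp only [if_pos c1, if_neg c2, prob_empty]
        ring
      · simp only [if_neg c1, if_pos c2, prob_empty]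
        ring
      · simp only [if_neg c1, if_neg c2, prob_empty]
        ring
    rw [e, div_eq_iff hm]
    split_ifs <;> ring

omit [Fintype V] [DecidablePred (· ∈ EA)] [DecidablePred (· ∈ EB)] in
/-- On a fibre `W ∋ y`, `Sy · F⁰_o / m_W = [a₁ ∈ W] F⁰_o − [a₂ ∈ W] F⁰_o`. -/
lemma term_y_of_mem (hp : IsProbVec p) {W : Finset V} (hW : y ∈ W) (γ : R) :
    Ssig p ends a₁ a₂ x y W * RootEdge.SFg p ends o a₁ a₂ x γ W / mW p ends a₁ a₂ x W =
      (if a₁ ∈ W then RootEdge.SFg p ends o a₁ a₂ x γ W else 0) -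
        (if a₂ ∈ W then RootEdge.SFg p ends o a₁ a₂ x γ W else 0) := by
  by_cases hm : mW p ends a₁ a₂ x W = 0
  · rw [hm, div_zero, SFg_eq_zero_of_mW_eq_zero hp o γ hm]
    simp
  · have e : Ssig p ends a₁ a₂ x y W =
        ((if a₁ ∈ W then 1 else 0) - (if a₂ ∈ W then 1 else 0)) * mW p ends a₁ a₂ x W := by
      unfold Ssig mW
      rw [fibre_inter_conn_y_of_mem hW a₁, fibre_inter_conn_y_of_mem hW a₂]
      by_cases c1 : a₁ ∈ W <;> by_cases c2 : a₂ ∈ W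
      · simp only [if_pos c1, if_pos c2]
        ring
      · simp only [if_pos c1, if_neg c2, prob_empty]
        ring
      · simp only [if_neg c1, if_pos c2, prob_empty]
        ring
      · simp only [if_neg c1, if_neg c2, prob_empty]
        ring
    rw [e, div_eq_iff hm]
    split_ifs <;> ring

omit [LinearOrder R] [IsStrictOrderedRing R] in
/-- The `F⁰_o`-sum over the fibres `W ∋ y, a₁ ∈ W, r ∈ W`: `γ P(Q, x ↔ y, x ↔ a₁, x ↔ r) −
2 P(Q, a₂ ↔ o, x ↔ y, x ↔ a₁, x ↔ r)`. -/
lemma sum_SFg_filter_a1 (o r : V) (γ : R) :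
    ∑ W ∈ Finset.univ.filter (fun W : Finset V => y ∈ W ∧ a₁ ∈ W ∧ r ∈ W),
        RootEdge.SFg p ends o a₁ a₂ x γ W =
      γ * prob p (avoidAll ends a₂ {a₁} ∩ Set.univ ∩
          (connEvent ends x y ∩ connEvent ends x a₁ ∩ connEvent ends x r)) -
        2 * prob p (avoidAll ends a₂ {a₁} ∩ connEvent ends a₂ o ∩
          (connEvent ends x y ∩ connEvent ends x a₁ ∩ connEvent ends x r)) := by
  have hFG : ∀ W, ∀ ω ∈ fibre ends a₁ a₂ x W, ((y ∈ W ∧ a₁ ∈ W ∧ r ∈ W) ↔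
      ω ∈ connEvent ends x y ∩ connEvent ends x a₁ ∩ connEvent ends x r) := by
    intro W ω hω
    rw [mem_iff_conn_of_mem_fibre hω y, mem_iff_conn_of_mem_fibre hω a₁,
      mem_iff_conn_of_mem_fibre hω r]
    simp only [Set.mem_inter_iff, and_assoc]
  rw [← sum_filter_fibre_inter Set.univ _ _ hFG, ← sum_filter_fibre_inter (connEvent ends a₂ o) _ _ hFG,
    Finset.mul_sum, Finset.mul_sum, ← Finset.sum_sub_distrib]
  refine Finset.sum_congr rfl fun W hW => ?_
  rw [SFg_of_mem_a1 o γ (Finset.mem_filter.1 hW).2.2.1, Set.inter_univ]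
  rfl

omit [LinearOrder R] [IsStrictOrderedRing R] in
/-- The `F⁰_o`-sum over the fibres `W ∋ y, a₂ ∈ W, r ∈ W`: `2 P(Q, a₁ ↔ o, x ↔ y, x ↔ a₂, x ↔ r) −
γ P(Q, x ↔ y, x ↔ a₂, x ↔ r)`. -/
lemma sum_SFg_filter_a2 (o r : V) (γ : R) :
    ∑ W ∈ Finset.univ.filter (fun W : Finset V => y ∈ W ∧ a₂ ∈ W ∧ r ∈ W),
        RootEdge.SFg p ends o a₁ a₂ x γ W =
      2 * prob p (avoidAll ends a₂ {a₁} ∩ connEvent ends a₁ o ∩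
          (connEvent ends x y ∩ connEvent ends x a₂ ∩ connEvent ends x r)) -
        γ * prob p (avoidAll ends a₂ {a₁} ∩ Set.univ ∩
          (connEvent ends x y ∩ connEvent ends x a₂ ∩ connEvent ends x r)) := by
  have hFG : ∀ W, ∀ ω ∈ fibre ends a₁ a₂ x W, ((y ∈ W ∧ a₂ ∈ W ∧ r ∈ W) ↔
      ω ∈ connEvent ends x y ∩ connEvent ends x a₂ ∩ connEvent ends x r) := by
    intro W ω hω
    rw [mem_iff_conn_of_mem_fibre hω y, mem_iff_conn_of_mem_fibre hω a₂,
      mem_iff_conn_of_mem_fibre hω r]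
    simp only [Set.mem_inter_iff, and_assoc]
  rw [← sum_filter_fibre_inter Set.univ _ _ hFG, ← sum_filter_fibre_inter (connEvent ends a₁ o) _ _ hFG,
    Finset.mul_sum, Finset.mul_sum, ← Finset.sum_sub_distrib]
  refine Finset.sum_congr rfl fun W hW => ?_
  rw [SFg_of_mem_a2 o γ (Finset.mem_filter.1 hW).2.2.1, Set.inter_univ]
  rfl

/-! ## The `σ_b`-sum pulls back -/
/-- `∑_{W ∋ y} Sb · F⁰_o / m_W = P(y ↔ b) · ∑_{W ∋ y} Sy · F⁰_o / m_W`. -/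
lemma sum_term_b_mem (hp : IsProbVec p) (h : IsCut ends y ↑VA ↑VB EA EB) (hx : x ∈ insert y VB)
    (h1 : a₁ ∈ insert y VB) (h2 : a₂ ∈ insert y VB) (ho : o ∈ insert y VB) (hb : b ∈ VA) (γ : R) :
    ∑ W ∈ Finset.univ.filter (fun W : Finset V => y ∈ W),
        Ssig p ends a₁ a₂ x b W * RootEdge.SFg p ends o a₁ a₂ x γ W / mW p ends a₁ a₂ x W =
      prob p (connEvent ends y b) *
        ∑ W ∈ Finset.univ.filter (fun W : Finset V => y ∈ W),
          Ssig p ends a₁ a₂ x y W * RootEdge.SFg p ends o a₁ a₂ x γ W / mW p ends a₁ a₂ x W := by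
  have eb : ∑ W ∈ Finset.univ.filter (fun W : Finset V => y ∈ W),
      Ssig p ends a₁ a₂ x b W * RootEdge.SFg p ends o a₁ a₂ x γ W / mW p ends a₁ a₂ x W =
      ∑ W ∈ Finset.univ.filter (fun W : Finset V => y ∈ W ∧ a₁ ∈ W ∧ b ∈ W),
          RootEdge.SFg p ends o a₁ a₂ x γ W -
        ∑ W ∈ Finset.univ.filter (fun W : Finset V => y ∈ W ∧ a₂ ∈ W ∧ b ∈ W),
          RootEdge.SFg p ends o a₁ a₂ x γ W := by
    rw [Finset.sum_filter, Finset.sum_filter, Finset.sum_filter, ← Finset.sum_sub_distrib]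
    refine Finset.sum_congr rfl fun W _ => ?_
    by_cases hW : y ∈ W
    · rw [if_pos hW, term_b_of_mem hp h h1 h2 hb hW γ]
      simp only [hW, true_and]
    · rw [if_neg hW, if_neg (show ¬ (y ∈ W ∧ a₁ ∈ W ∧ b ∈ W) from fun hc => hW hc.1),
        if_neg (show ¬ (y ∈ W ∧ a₂ ∈ W ∧ b ∈ W) from fun hc => hW hc.1), sub_zero]
  have ey : ∑ W ∈ Finset.univ.filter (fun W : Finset V => y ∈ W),
      Ssig p ends a₁ a₂ x y W * RootEdge.SFg p ends o a₁ a₂ x γ W / mW p ends a₁ a₂ x W =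
      ∑ W ∈ Finset.univ.filter (fun W : Finset V => y ∈ W ∧ a₁ ∈ W ∧ y ∈ W),
          RootEdge.SFg p ends o a₁ a₂ x γ W -
        ∑ W ∈ Finset.univ.filter (fun W : Finset V => y ∈ W ∧ a₂ ∈ W ∧ y ∈ W),
          RootEdge.SFg p ends o a₁ a₂ x γ W := by
    rw [Finset.sum_filter, Finset.sum_filter, Finset.sum_filter, ← Finset.sum_sub_distrib]
    refine Finset.sum_congr rfl fun W _ => ?_
    by_cases hW : y ∈ W
    · rw [if_pos hW, term_y_of_mem hp hW γ]
      simp only [hW, true_and, and_true]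
    · rw [if_neg hW, if_neg (show ¬ (y ∈ W ∧ a₁ ∈ W ∧ y ∈ W) from fun hc => hW hc.1),
        if_neg (show ¬ (y ∈ W ∧ a₂ ∈ W ∧ y ∈ W) from fun hc => hW hc.1), sub_zero]
  have hQ := avoidAll_eq_sideEventB' h h1 h2
  rw [eb, ey, sum_SFg_filter_a1 o b γ, sum_SFg_filter_a2 o b γ, sum_SFg_filter_a1 o y γ,
    sum_SFg_filter_a2 o y γ, Set.inter_univ, prob_inter_conn_b h hx hb h1 hQ,
    prob_inter_conn_b h hx hb h2 hQ,
    prob_inter_conn_b h hx hb h1 (inter_eq_sideEventB hQ (connEvent_eq_sideEventB' h h2 ho)),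
    prob_inter_conn_b h hx hb h2 (inter_eq_sideEventB hQ (connEvent_eq_sideEventB' h h1 ho)),
    inter_conn_y_self, inter_conn_y_self, inter_conn_y_self, inter_conn_y_self]
  ring

/-- `∑_W Sb · F⁰_o / m_W = P(y ↔ b) · ∑_W Sy · F⁰_o / m_W`. -/
lemma sum_term_pull_b (hp : IsProbVec p) (h : IsCut ends y ↑VA ↑VB EA EB) (hx : x ∈ insert y VB)
    (h1 : a₁ ∈ insert y VB) (h2 : a₂ ∈ insert y VB) (ho : o ∈ insert y VB) (hb : b ∈ VA) (γ : R) :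
    ∑ W : Finset V, Ssig p ends a₁ a₂ x b W * RootEdge.SFg p ends o a₁ a₂ x γ W /
        mW p ends a₁ a₂ x W =
      prob p (connEvent ends y b) *
        ∑ W : Finset V, Ssig p ends a₁ a₂ x y W * RootEdge.SFg p ends o a₁ a₂ x γ W /
          mW p ends a₁ a₂ x W := by
  rw [← Finset.sum_filter_add_sum_filter_not Finset.univ (fun W : Finset V => y ∈ W),
    ← Finset.sum_filter_add_sum_filter_not Finset.univ (fun W : Finset V => y ∈ W), mul_add,
    sum_term_b_mem hp h hx h1 h2 ho hb γ]
  congr 1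
  rw [Finset.mul_sum]
  refine Finset.sum_congr rfl fun W hW => ?_
  rw [Ssig_pull_notMem h hx h1 h2 hb (Finset.mem_filter.1 hW).2]
  ring

omit [LinearOrder R] [IsStrictOrderedRing R] in
/-- `∑_W Sb = P(y ↔ b) · ∑_W Sy`. -/
lemma sum_Ssig_pull (h : IsCut ends y ↑VA ↑VB EA EB) (h1 : a₁ ∈ insert y VB)
    (h2 : a₂ ∈ insert y VB) (hb : b ∈ VA) :
    ∑ W : Finset V, Ssig p ends a₁ a₂ x b W =
      prob p (connEvent ends y b) * ∑ W : Finset V, Ssig p ends a₁ a₂ x y W := by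
  have e : ∀ v : V, ∑ W : Finset V, Ssig p ends a₁ a₂ x v W =
      prob p (avoidAll ends a₂ {a₁} ∩ connEvent ends a₁ v) -
        prob p (avoidAll ends a₂ {a₁} ∩ connEvent ends a₂ v) := by
    intro v
    unfold Ssig
    rw [Finset.sum_sub_distrib, sum_prob_fibre_inter, sum_prob_fibre_inter]
  rw [e, e, prob_inter_conn_pull h h1 hb (avoidAll_eq_sideEventB' h h1 h2),
    prob_inter_conn_pull h h2 hb (avoidAll_eq_sideEventB' h h1 h2)]
  ring

omit [LinearOrder R] [IsStrictOrderedRing R] in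
/-- `∑_A Sub = P(y ↔ b) · ∑_A Suy`. -/
lemma sum_SuA_pull_b (h : IsCut ends y ↑VA ↑VB EA EB) (hx : x ∈ insert y VB)
    (h1 : a₁ ∈ insert y VB) (h2 : a₂ ∈ insert y VB) (hb : b ∈ VA) :
    ∑ W ∈ fibresA a₁ a₂, Su p ends a₁ a₂ x b W =
      prob p (connEvent ends y b) * ∑ W ∈ fibresA a₁ a₂, Su p ends a₁ a₂ x y W := by
  rw [← Do_eq_fibresA, ← Do_eq_fibresA, Do_pull h hx h1 h2 hb]

omit [LinearOrder R] [IsStrictOrderedRing R] in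
/-- `∑_A Sub · Suo / m_W = P(y ↔ b) · ∑_A Suy · Suo / m_W`. -/
lemma sum_termA_pull_b (h : IsCut ends y ↑VA ↑VB EA EB) (hx : x ∈ insert y VB)
    (h1 : a₁ ∈ insert y VB) (h2 : a₂ ∈ insert y VB) (hb : b ∈ VA) :
    ∑ W ∈ fibresA a₁ a₂, Su p ends a₁ a₂ x b W * Su p ends a₁ a₂ x o W / mW p ends a₁ a₂ x W =
      prob p (connEvent ends y b) *
        ∑ W ∈ fibresA a₁ a₂, Su p ends a₁ a₂ x y W * Su p ends a₁ a₂ x o W /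
          mW p ends a₁ a₂ x W := by
  rw [Finset.mul_sum]
  refine Finset.sum_congr rfl fun W hW => ?_
  rw [Su_pull_fibresA h hx h1 h2 hb hW]
  ring

/-! ## The pull-back -/

/-- **The mark `b` pulls back to the cut vertex**: `btw(x; b) = P(y ↔ b) · btw(x; y)`. -/
theorem btw_pull_b (hp : IsProbVec p) (h : IsCut ends y ↑VA ↑VB EA EB) (hx : x ∈ insert y VB)
    (h1 : a₁ ∈ insert y VB) (h2 : a₂ ∈ insert y VB) (ho : o ∈ insert y VB) (hb : b ∈ VA) :
    btw p ends o a₁ a₂ x b = prob p (connEvent ends y b) * btw p ends o a₁ a₂ x y := by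
  rw [← RootEdge.btwg_gamma, ← RootEdge.btwg_gamma]
  unfold RootEdge.btwg
  rw [sum_term_pull_b hp h hx h1 h2 ho hb, sum_Ssig_pull h h1 h2 hb, sum_termA_pull_b h hx h1 h2 hb,
    sum_SuA_pull_b h hx h1 h2 hb]
  ring

/-- **The mark `b` pulls back to the cut vertex in the first-order functional**:
`FMfun(x; b) = P(y ↔ b) · FMfun(x; y)`. -/
theorem FMfun_pull_b (hp : IsProbVec p) (h : IsCut ends y ↑VA ↑VB EA EB) (hx : x ∈ insert y VB)
    (h1 : a₁ ∈ insert y VB) (h2 : a₂ ∈ insert y VB) (ho : o ∈ insert y VB) (hb : b ∈ VA) :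
    FMfun p ends o a₁ a₂ x b = prob p (connEvent ends y b) * FMfun p ends o a₁ a₂ x y := by
  unfold FMfun
  rw [sum_term_pull_b hp h hx h1 h2 ho hb, sum_Ssig_pull h h1 h2 hb, sum_termA_pull_b h hx h1 h2 hb,
    sum_SuA_pull_b h hx h1 h2 hb, mU_pull h h1 h2 hb]
  ring

/-- (MEANS-a₃) at `x` with the mark `b` behind the cut vertex `y` follows from (MEANS-a₃) at `x` with
the mark moved to `y`. -/
theorem A3Between_pull_b (hp : IsProbVec p) (h : IsCut ends y ↑VA ↑VB EA EB) (hx : x ∈ insert y VB)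
    (h1 : a₁ ∈ insert y VB) (h2 : a₂ ∈ insert y VB) (ho : o ∈ insert y VB) (hb : b ∈ VA)
    (hy : A3Between p ends o a₁ a₂ x y) : A3Between p ends o a₁ a₂ x b := by
  unfold A3Between
  rw [btw_pull_b hp h hx h1 h2 ho hb]
  exact mul_nonneg (prob_nonneg hp _) hy

/-- (FM) at `x` with the mark `b` behind the cut vertex `y` follows from (FM) at `x` with the mark
moved to `y`. -/
theorem FM_pull_b (hp : IsProbVec p) (h : IsCut ends y ↑VA ↑VB EA EB) (hx : x ∈ insert y VB)
    (h1 : a₁ ∈ insert y VB) (h2 : a₂ ∈ insert y VB) (ho : o ∈ insert y VB) (hb : b ∈ VA)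
    (hy : FM p ends o a₁ a₂ x y) : FM p ends o a₁ a₂ x b := by
  unfold FM
  rw [FMfun_pull_b hp h hx h1 h2 ho hb]
  exact mul_nonneg (prob_nonneg hp _) hy

/-- (HCOV) at `x` with the mark `b` behind the cut vertex `y` follows from (MEANS-a₃) at `x` with the
mark moved to `y`. -/
theorem HCov_pull_b (hp : IsProbVec p) (h : IsCut ends y ↑VA ↑VB EA EB) (hx : x ∈ insert y VB)
    (h1 : a₁ ∈ insert y VB) (h2 : a₂ ∈ insert y VB) (ho : o ∈ insert y VB) (hb : b ∈ VA)
    (hy : A3Between p ends o a₁ a₂ x y) : HCov p ends o a₁ a₂ x b :=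
  HCov_of_a3Between hp ends o a₁ a₂ x b (A3Between_pull_b hp h hx h1 h2 ho hb hy)

end PullB

end MarkPull

end A3Fibre

end CovForm

end Summit.Ventures.PercRepro2
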